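import Summits.QuantumFields.YangMills.Theorems.BalabanUVNodesK0V23Defs
import Summits.QuantumFields.YangMills.Theorems.BalabanUVNodesK0V23Stub1Closer
import Summits.QuantumFields.YangMills.Theorems.BalabanUVNodesK0V23Stub3ComparabilitySuppliers
import Literature.MathematicalPhysics.QuantumFieldTheory.Balaban1983to89.B8Prop6PrintedZdCubPGamma
import Summits.QuantumFields.YangMills.Theses.BalabanUVNodes

/-!
# CRIT-1 (g31) — K0⁷'s WHOLE RESIDUAL NEED AFTER V23 + THE STUB-1ᴮ CLOSER, BY NAME: the registered |β| BOX (door α) and the unregistered COMPARABILITY CORE (door β)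

Cell `ym-nodeO-ideate`, CRITIC seat `ym-nodeO-crit-1` (refuter-ym-nodeO-crit-1-g31-0; count-neutral; a crux WORKFILE, not a gate filing).
Written after plan g97 REGISTERED the V23 skeleton on K0⁷ (`stmt-QuantumFields-20541`, sha d01c50abc247f5ff, 2026-08-30T16:05:37Z) and dag-n07-e CLOSED stub 1ᴮ BY NAME
(✓p778618 `Thm/BalabanUVNodesK0V23Stub1Closer`, 16:17:47Z; director-ym №392).  PURPOSE (located-B for every NODE O ∕ (D4) card on the K0 road, kernel-checked): K0⁷'s Theses decl
`Record13SepCoPHInhabited` (VERBATIM, `Theses/BalabanUVNodes.lean` :276–:277) now follows BY NAME from EITHER of two NODE O letters ALONE —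
(α) the REGISTERED stub-3ᴬ′ᴮ text `∀ F, K0V23Defs.AbsBetaBoxAtThm1WitnessCCMGenGridGZBAt F` (the sign-free |β| box at the letter-free print-regime member), composed exactly as the
registered skeleton composes it (`K0V23Defs.k0Body_of_stub1B_of_2P_of_3B` with the seam `rfl`, the closer's `stub_prop8StepCoPGridGB13`, and stub 2′ from green Literature); or
(β) the UNREGISTERED, WEAKER comparability core (`K0V23Stub3ComparabilitySuppliers.k0Body_of_seam_of_twoComparableZB`, which needs neither stub 1ᴮ nor the (8)∕(9) antecedents).
Nothing of Bałaban is asserted: (α) and (β) are HYPOTHESES here; K0⁷ is NOT closed; NODE O is not inhabited; the Yang–Mills mass gap (Clay) is NOT proved by any of this; R4 closes only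
the CONDITIONAL finite-𝕋⁴ rung `BalabanLadder.UV`.
-/

noncomputable section

open scoped Matrix.Norms.L2Operator
open Literature.MathematicalPhysics.QuantumFieldTheory.Balaban1983to89
open Literature.MathematicalPhysics.QuantumFieldTheory.Balaban1983to89.Node00
open Literature.MathematicalPhysics.QuantumFieldTheory.Balaban1983to89.T4Continuum
open Literature.MathematicalPhysics.QuantumFieldTheory.Balaban1983to89.FlowStep
open Literature.MathematicalPhysics.QuantumFieldTheory.Balaban1983to89.B15DeterminingSets
open Literature.MathematicalPhysics.QuantumFieldTheory.Balaban1983to89.B8LeafModelZd (ZdIdx)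
open Literature.MathematicalPhysics.QuantumFieldTheory.Balaban1983to89.B8Prop6PrintedZdCubPGamma (prop6Printed_zdCubP_γ_holds_pos)
open Summit.QuantumFields.YangMills.Theorems.K0V23Defs (Prop8StepCoPGridGBAt AbsBetaBoxAtThm1WitnessCCMGenGridGZBAt AbsBetaBoxAtThm1WitnessCCMGenGridGZBEps0At
  k0Body_of_stub1B_of_2P_of_3B absBetaBoxGenGridGZBAt_of_eps0)
open Summit.QuantumFields.YangMills.Theorems.K0V23Stub3ComparabilitySuppliers (k0Body_of_seam_of_twoComparableZB)

namespace Summit.QuantumFields.YangMills.Cruxes.Record13SepCoPHInhabited.Crit1K0BoxTarget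

/-- **Door (α), the REGISTERED K0⁷ letter of record** — the one open stub of skeleton d01c50abc247f5ff: NODE O's sign-free |β| box at the print-regime member, for every family.
[cite: Balaban1985Variational, Thm 1 (8),(9) p.279; Balaban1987RG1, Thm 1 p.259, §1 p.264, (1.20)–(1.22) p.264] -/
def K0BoxTarget : Prop := ∀ F : T4Family, AbsBetaBoxAtThm1WitnessCCMGenGridGZBAt F

/-- **Door (α⁺), the strengthened text with the LOCATED-K0ε₀ letter `2·a₀ ≤ ε₀·L²`** (extra credit; implies (α) by `absBetaBoxGenGridGZBAt_of_eps0`). [cite: Balaban1987RG1, Thm 1 p.259, (0.21) p.256] -/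
def K0BoxTargetEps0 : Prop := ∀ F : T4Family, AbsBetaBoxAtThm1WitnessCCMGenGridGZBEps0At F

/-- **Door (β), UNREGISTERED and WEAKER** — the comparability core (VERBATIM the `comp` binder of `k0Body_of_seam_of_twoComparableZB`): runwise 2-comparability of every γ₀-interval RG
trajectory of the letter-free member's β of record, γ₀ ε₂₉ chosen per `(F, a₀)` uniformly in `(j, ε₀, B₃, B₃', a₁)`. [cite: Balaban1987RG1, Thm 3 p.264, (1.20)–(1.22) p.264] -/
def K0ComparabilityCore : Prop :=
  ∀ (F : T4Family) (a₀ : ℝ), 0 < a₀ → ∃ γ₀ ε₂₉ : ℝ, 0 < γ₀ ∧ 0 < ε₂₉ ∧ ∀ (j : ℕ) (ε₀ B₃ B₃' a₁ : ℝ),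
    ∀ (n : ℕ) (gs : ℕ → ℝ), RGEqH n (betaOfRecord₁₃ F 2 (theta13OfThm1CCMWZB F 2 j (1 / 2) a₀ ε₀ ε₂₉ B₃ B₃' a₀ a₁ (fun _ _ => 0) (fun _ _ => 0))) gs → Step.InInterval γ₀ n gs →
      ∀ m, m < n → gs m ≤ 2 * gs (m + 1) ∧ gs (m + 1) ≤ 2 * gs m

/-- **POST-SEAM the displayed `hseam` is `rfl`** (✓p775188 `Node00.UbgOfRecord₁₃CoP_succ`; the skeleton's `seam₁₃CoP_holds`). [cite: Balaban1988Convergent, (2.12)–(2.13) pp.256–257] -/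
theorem hseam_rfl :
    ∀ (F : T4Family) (θ : Stage13Params F 2) (p : B12.RunParams) (n : ℕ) (s : SeqOfRecord F θ.ν θ.τ9.M (gOfRecord₁₃ F 2 θ p) p.K (n + 1)) (W : MSField (F.P p.K) (SU 2)),
      UbgOfRecord₁₃CoP F 2 θ p (n + 1) s W = UbgMSCoPOfRecordB F 2 θ.ν θ.τ9.M (gOfRecord₁₃ F 2 θ p) p.K (n + 1) s W :=
  fun _ _ _ _ _ _ => rfl

/-- **Stub 2′'s sentence from green Literature** (the skeleton's §3b five-liner, VERBATIM). [cite: Balaban1985RegularSpaces, Prop. 6 (1.135)–(1.138) p.99, (1.3)–(1.6) p.77] -/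
theorem prop6MemberB8AtP_of_b8Printed :
    ∀ F : T4Family, ∃ (ρ₀ : ℕ) (B₁ c₁ : ℝ), 1 ≤ ρ₀ ∧ 0 ≤ B₁ ∧ 0 < c₁ ∧
      (letI : CStarAlgebra (MatA 2) := {}; B8.Prop6Printed 4 (F.L : ℝ) B₁ c₁ (fun i : ZdIdx 4 F.L => zdCubP (MatA 2) F.L ρ₀ i)) := by
  intro F
  letI : CStarAlgebra (MatA 2) := {}
  have hL5 : 5 ≤ F.L := by have := F.hL11; omega
  obtain ⟨ρ₀, B₁, c₁, hρ₀, hB₁, hc₁, H⟩ :=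
    prop6Printed_zdCubP_γ_holds_pos (𝔸 := MatA 2) (d := 4) (by norm_num) hL5 F.hL.1
  exact ⟨ρ₀, B₁, c₁, hρ₀, hB₁.le, hc₁, H (fun i : ZdIdx 4 F.L => i)⟩

/-- **★ (α) K0⁷'s DECL FROM THE REGISTERED |β| BOX ALONE, BY NAME** — seam `rfl` + the stub-1ᴮ closer ✓p778618 + stub 2′ from Literature + the box as the ONE hypothesis; i.e. after
16:17:47Z the K0⁷ item IS NODE O's box at the print-regime member and nothing else.  CONDITIONAL on the box; K0⁷ NOT closed.
[cite: Balaban1985Variational, Thm 1 (8)–(9) p.279, Prop. 8 p.304; Balaban1985RegularSpaces, Prop. 6 p.99; Balaban1988Convergent, Thm 1 p.262; Balaban1987RG1, Thm 1 p.259, §1 p.264] -/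
theorem record13SepCoPHInhabited_of_k0BoxTarget (h3 : K0BoxTarget) :
    Summit.QuantumFields.YangMills.Theses.BalabanUVNodes.Record13SepCoPHInhabited :=
  k0Body_of_stub1B_of_2P_of_3B hseam_rfl Summit.QuantumFields.YangMills.Theorems.K0V23Stub1Closer.stub_prop8StepCoPGridGB13 prop6MemberB8AtP_of_b8Printed h3

/-- **(α⁺) the strengthened text closes K0⁷ likewise.** [cite: Balaban1987RG1, Thm 1 p.259, (0.21) p.256] -/
theorem record13SepCoPHInhabited_of_k0BoxTargetEps0 (h3e : K0BoxTargetEps0) :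
    Summit.QuantumFields.YangMills.Theses.BalabanUVNodes.Record13SepCoPHInhabited :=
  record13SepCoPHInhabited_of_k0BoxTarget fun F => absBetaBoxGenGridGZBAt_of_eps0 F (h3e F)

/-- **★ (β) K0⁷'s DECL FROM THE UNREGISTERED COMPARABILITY CORE ALONE, BY NAME** (needs neither stub 1ᴮ nor the (8)∕(9) antecedents; the door the plan seat MAY re-register stub 3 on).
CONDITIONAL on the core; K0⁷ NOT closed. [cite: Balaban1987RG1, Thm 3 p.264, (1.20)–(1.22) p.264; Balaban1988Convergent, Thm 1 p.262, (2.6)–(2.8) pp.255–256] -/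
theorem record13SepCoPHInhabited_of_k0ComparabilityCore (comp : K0ComparabilityCore) :
    Summit.QuantumFields.YangMills.Theses.BalabanUVNodes.Record13SepCoPHInhabited :=
  k0Body_of_seam_of_twoComparableZB hseam_rfl comp

end Summit.QuantumFields.YangMills.Cruxes.Record13SepCoPHInhabited.Crit1K0BoxTarget

end
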